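import Summits.FinalStateConjecture.FinalStateConjecture.Theorems.EIHFluxBalanceInertialRecessionStubHigherOrderSymbolStep
import Summits.FinalStateConjecture.FinalStateConjecture.Theorems.EIHFluxBalanceInertialRecessionStubHigherOrderSmulJets
import Summits.FinalStateConjecture.FinalStateConjecture.Theorems.EIHFluxBalanceInertialRecessionStubSlaving12JetCalculus
import Summits.FinalStateConjecture.FinalStateConjecture.Theorems.EIHFluxBalanceInertialRecessionCalculus

/-!
# Route EIHFluxBalance — `InertialRecession` (E′), line `SketchCleanExcision`, skeleton r13,
# stub `stub_higherOrderSlaving` (EF): applying the coercivity statement to a re-centred field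

Helper file for the crux `stmt-FinalStateConjecture-17403`
(`Summit.FinalStateConjecture.FinalStateConjecture.Theses.EIHFluxBalance.InertialRecession`, E′),
registered stub `stub_higherOrderSlaving` (orders two and three of frozen-vacuum slaving).

Given a field of metric components `G` on an open set containing the coercivity shell
`{(0, y) : ρin ≤ ‖y‖ ≤ ρout}`, `η₀`-close there to the boosted Kerr `K = boostedKerrBilin L 0 M a`,
the coercivity clause of `stub_coerSymbolQuant` (hypothesis `hcoer`, with its constants) is applied
to the pair `G`, `G' = G + ½(x⁰)² • W` with `W` the variation form of `(L, A, d)`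
(`higherOrder_varField…`): both are metric components on a neighbourhood of the shell
(`higherOrder_isMetricOn_add_smul`: a perturbation vanishing to second order on the slice keeps
nondegeneracy nearby) with the required jets (`higherOrder_jets_smul_sq`). Comparing with the field
`G₁ = G − ½(x⁰)² • P` for any smooth symmetric `P` (`higherOrder_norm_ricAt_changes_add_le`) gives
`higherOrder_applyCB₂`: at the point `x_y` produced by coercivity,
`c · red(A, d) ≤ 4‖♯‖‖dx⁰‖² ‖W(x_y) − P(x_y)‖ + ‖Ric G₁(x_y)‖ + ‖Ric G(x_y)‖`.

No definitions, no named facts, no `sorry`.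
-/

set_option linter.dupNamespace false
set_option maxSynthPendingDepth 6
set_option synthInstance.maxHeartbeats 200000

noncomputable section

namespace Summit.FinalStateConjecture.FinalStateConjecture.Theorems.SublinearIsFree.Slaving

open scoped Topology ContDiff
open Filter Set Function Metric Literature.Geometry.Lorentzian
  Summit.FinalStateConjecture.FinalStateConjecture.Theorems
open MetricCoord

/-! ### Perturbations vanishing on the slice keep nondegeneracy nearby -/

/-- **A field of metric components plus `f • B` is a field of metric components where
`‖f B‖ ‖♯‖ < 1`**, an open set containing the zeros of `f` in `V`. [folklore] -/
theorem higherOrder_isMetricOn_add_smul {G B : E4 → E4 →L[ℝ] E4 →L[ℝ] ℝ} {V : Set E4}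
    (hG : IsMetricOn G V) {f : E4 → ℝ} (hf : ContDiff ℝ ∞ f) (hB : ContDiffOn ℝ ∞ B V)
    (hBs : ∀ w ∈ V, ∀ u v, B w u v = B w v u) :
    IsMetricOn (fun w ↦ G w + f w • B w) {w | w ∈ V ∧ ‖f w • B w‖ * ‖sharpAt G w‖ < 1} ∧
      ∀ w ∈ V, f w = 0 → w ∈ {w | w ∈ V ∧ ‖f w • B w‖ * ‖sharpAt G w‖ < 1} := by
  have hcont : ContinuousOn (fun w ↦ ‖f w • B w‖ * ‖sharpAt G w‖) V :=
    ((hf.continuous.continuousOn.smul hB.continuousOn).norm).mul hG.contDiffOn_sharpAt.continuousOn.norm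
  have hopen : IsOpen {w | w ∈ V ∧ ‖f w • B w‖ * ‖sharpAt G w‖ < 1} :=
    hcont.isOpen_inter_preimage hG.isOpen isOpen_Iio
  refine ⟨⟨hopen, ?_, ?_, ?_⟩, fun w hw hf0 ↦ ⟨hw, by rw [hf0, zero_smul, norm_zero, zero_mul]; exact one_pos⟩⟩
  · exact (hG.contDiffOn.add (hf.contDiffOn.smul hB)).mono fun w hw ↦ hw.1
  · intro w hw u v
    simp only [_root_.add_apply, _root_.smul_apply, hG.symm w hw.1 u v, hBs w hw.1 u v]
  · intro w hw
    refine MetricCoord.isInvertible_of_nondegenerate fun v hv ↦ ?_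
    have h0 : (G w + f w • B w) v = 0 := ContinuousLinearMap.ext fun u ↦ hv u
    have hGv : G w v = -((f w • B w) v) := by
      rw [_root_.add_apply] at h0; exact eq_neg_of_add_eq_zero_left h0
    have hv' : v = sharpAt G w (G w v) := (sharpAt_apply (hG.isInvertible w hw.1) v).symm
    have hn : ‖v‖ ≤ ‖f w • B w‖ * ‖sharpAt G w‖ * ‖v‖ := by
      calc ‖v‖ = ‖sharpAt G w (G w v)‖ := by rw [← hv']
        _ ≤ ‖sharpAt G w‖ * ‖G w v‖ := (sharpAt G w).le_opNorm _
        _ = ‖sharpAt G w‖ * ‖(f w • B w) v‖ := by rw [hGv, norm_neg]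
        _ ≤ ‖sharpAt G w‖ * (‖f w • B w‖ * ‖v‖) := by gcongr; exact (f w • B w).le_opNorm v
        _ = _ := by ring
    by_contra hne
    have hpos : 0 < ‖v‖ := norm_pos_iff.2 hne
    have : 1 ≤ ‖f w • B w‖ * ‖sharpAt G w‖ := by
      by_contra h; push Not at h; nlinarith
    exact absurd hw.2 (not_lt.2 this)

/-! ### The variation field of the coercivity statement -/

/-- Smoothness of `w ↦ (T w)(B·, C·)` for smooth `T` and constant `B`, `C`. [folklore] -/
theorem higherOrder_contDiffOn_bilinearComp_const {T : E4 → E4 →L[ℝ] E4 →L[ℝ] ℝ} {U : Set E4}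
    (hT : ContDiffOn ℝ ∞ T U) (B C : E4 →L[ℝ] E4) :
    ContDiffOn ℝ ∞ (fun w ↦ (T w).bilinearComp B C) U := by
  -- `T(B·, C·) = (compL.flip C) ∘ (T ∘ B)` (cf. `coerMomQ_bilinearComp_eq_comp`)
  have h : (fun w ↦ (T w).bilinearComp B C) =
      fun w ↦ ((ContinuousLinearMap.compL ℝ E4 E4 ℝ).flip C).comp ((T w).comp B) :=
    funext fun w ↦ by ext v u; simp
  rw [h]
  exact contDiffOn_const.clm_comp (hT.clm_comp contDiffOn_const)

/-- The derivative of the Kerr–Schild components is a symmetric form. [folklore] -/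
theorem higherOrder_fderiv_kerr_bilin_symm (M a : ℝ) {y : E4} (hy : 0 < Kerr.radius a y) (v u w : E4) :
    fderiv ℝ (Kerr.bilin M a) y v u w = fderiv ℝ (Kerr.bilin M a) y v w u := by
  have hd : DifferentiableAt ℝ (Kerr.bilin M a) y := (Kerr.contDiffAt_bilin M a hy (n := ∞)).differentiableAt (by simp)
  have h1 : fderiv ℝ (Kerr.bilin M a) y v u w = fderiv ℝ (fun z ↦ Kerr.bilin M a z u w) y v := by
    rw [fderiv_clm_apply (hd.clm_apply (differentiableAt_const u)) (differentiableAt_const w),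
      fderiv_clm_apply hd (differentiableAt_const u)]
    simp
  have h2 : fderiv ℝ (Kerr.bilin M a) y v w u = fderiv ℝ (fun z ↦ Kerr.bilin M a z w u) y v := by
    rw [fderiv_clm_apply (hd.clm_apply (differentiableAt_const w)) (differentiableAt_const u),
      fderiv_clm_apply hd (differentiableAt_const w)]
    simp
  rw [h1, h2]
  congr 2
  funext z
  exact Kerr.bilin_symm M a z u w

/-- **The variation field of the coercivity statement is smooth where the painted radius is
positive, and symmetric.** [folklore] -/
theorem higherOrder_varField (L : lorentzGroup) (A : E4 →L[ℝ] E4) (d : E4) (M a : ℝ) :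
    ContDiffOn ℝ ∞ (fun w : E4 ↦
      (fderiv ℝ (Kerr.bilin M a) (poincareInv L 0 w) (A (poincareInv L 0 w) + d)).bilinearComp
          (((L : E4 ≃L[ℝ] E4).symm : E4 →L[ℝ] E4)) (((L : E4 ≃L[ℝ] E4).symm : E4 →L[ℝ] E4)) +
        (Kerr.bilin M a (poincareInv L 0 w)).bilinearComp (A.comp (((L : E4 ≃L[ℝ] E4).symm : E4 →L[ℝ] E4)))
          (((L : E4 ≃L[ℝ] E4).symm : E4 →L[ℝ] E4)) +
        (Kerr.bilin M a (poincareInv L 0 w)).bilinearComp (((L : E4 ≃L[ℝ] E4).symm : E4 →L[ℝ] E4))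
          (A.comp (((L : E4 ≃L[ℝ] E4).symm : E4 →L[ℝ] E4))))
      {w : E4 | 0 < Kerr.radius a (poincareInv L 0 w)} ∧
    ∀ w : E4, 0 < Kerr.radius a (poincareInv L 0 w) → ∀ u v : E4,
      ((fderiv ℝ (Kerr.bilin M a) (poincareInv L 0 w) (A (poincareInv L 0 w) + d)).bilinearComp
          (((L : E4 ≃L[ℝ] E4).symm : E4 →L[ℝ] E4)) (((L : E4 ≃L[ℝ] E4).symm : E4 →L[ℝ] E4)) +
        (Kerr.bilin M a (poincareInv L 0 w)).bilinearComp (A.comp (((L : E4 ≃L[ℝ] E4).symm : E4 →L[ℝ] E4)))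
          (((L : E4 ≃L[ℝ] E4).symm : E4 →L[ℝ] E4)) +
        (Kerr.bilin M a (poincareInv L 0 w)).bilinearComp (((L : E4 ≃L[ℝ] E4).symm : E4 →L[ℝ] E4))
          (A.comp (((L : E4 ≃L[ℝ] E4).symm : E4 →L[ℝ] E4)))) u v =
      ((fderiv ℝ (Kerr.bilin M a) (poincareInv L 0 w) (A (poincareInv L 0 w) + d)).bilinearComp
          (((L : E4 ≃L[ℝ] E4).symm : E4 →L[ℝ] E4)) (((L : E4 ≃L[ℝ] E4).symm : E4 →L[ℝ] E4)) +
        (Kerr.bilin M a (poincareInv L 0 w)).bilinearComp (A.comp (((L : E4 ≃L[ℝ] E4).symm : E4 →L[ℝ] E4)))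
          (((L : E4 ≃L[ℝ] E4).symm : E4 →L[ℝ] E4)) +
        (Kerr.bilin M a (poincareInv L 0 w)).bilinearComp (((L : E4 ≃L[ℝ] E4).symm : E4 →L[ℝ] E4))
          (A.comp (((L : E4 ≃L[ℝ] E4).symm : E4 →L[ℝ] E4)))) v u := by
  set S : E4 →L[ℝ] E4 := (((L : E4 ≃L[ℝ] E4).symm : E4 →L[ℝ] E4)) with hS
  have hP : ∀ w : E4, poincareInv L 0 w = S w := fun w ↦ by simp [poincareInv, hS]
  have hPf : (poincareInv L 0 : E4 → E4) = S := funext hP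
  have hPc : ContDiff ℝ ∞ (poincareInv L 0 : E4 → E4) := by rw [hPf]; exact S.contDiff
  set O : Set E4 := {w : E4 | 0 < Kerr.radius a (poincareInv L 0 w)} with hO
  have hOo : IsOpen O := by
    have hc : Continuous fun w : E4 ↦ Kerr.radius a (poincareInv L 0 w) := by
      have h := (Kerr.continuous_radius a).comp (S.continuous); simp only [hP]; exact h
    exact isOpen_lt continuous_const hc
  -- smoothness of `K ∘ S` and `DK ∘ S` on `O`
  have hK : ContDiffOn ℝ ∞ (fun w : E4 ↦ Kerr.bilin M a (poincareInv L 0 w)) O := fun w hw ↦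
    ((Kerr.contDiffAt_bilin M a hw).comp w hPc.contDiffAt).contDiffWithinAt
  have hDK : ContDiffOn ℝ ∞ (fun w : E4 ↦ fderiv ℝ (Kerr.bilin M a) (poincareInv L 0 w)) O := by
    intro w hw
    have hKc : ContDiffOn ℝ ∞ (Kerr.bilin M a) {y : E4 | 0 < Kerr.radius a y} := fun y hy ↦
      (Kerr.contDiffAt_bilin M a hy).contDiffWithinAt
    have hKo : IsOpen {y : E4 | 0 < Kerr.radius a y} := isOpen_lt continuous_const (Kerr.continuous_radius a)
    have hDKc : ContDiffOn ℝ ∞ (fderiv ℝ (Kerr.bilin M a)) {y : E4 | 0 < Kerr.radius a y} :=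
      hKc.fderiv_of_isOpen hKo (by simp)
    exact ((hDKc.contDiffAt (hKo.mem_nhds hw)).comp w hPc.contDiffAt).contDiffWithinAt
  have hdir : ContDiff ℝ ∞ (fun w : E4 ↦ A (poincareInv L 0 w) + d) := by
    simp only [hP]; exact (A.contDiff.comp S.contDiff).add contDiff_const
  have hT : ContDiffOn ℝ ∞ (fun w : E4 ↦ fderiv ℝ (Kerr.bilin M a) (poincareInv L 0 w) (A (poincareInv L 0 w) + d)) O :=
    hDK.clm_apply hdir.contDiffOn
  refine ⟨((higherOrder_contDiffOn_bilinearComp_const hT S S).add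
    (higherOrder_contDiffOn_bilinearComp_const hK (A.comp S) S)).add
    (higherOrder_contDiffOn_bilinearComp_const hK S (A.comp S)), fun w hw u v ↦ ?_⟩
  simp only [_root_.add_apply, ContinuousLinearMap.bilinearComp_apply, ContinuousLinearMap.coe_comp,
    Function.comp_apply]
  rw [higherOrder_fderiv_kerr_bilin_symm M a hw, Kerr.bilin_symm M a _ (A (S u)) (S v),
    Kerr.bilin_symm M a _ (S u) (A (S v))]
  ring


/-! ### Applying the coercivity clause -/

set_option maxHeartbeats 3200000 in
/-- **Applying the coercivity clause of `stub_coerSymbolQuant` to a re-centred field.** See the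
module docstring. [folklore] -/
theorem higherOrder_applyCB₂ {M a γ c ρin ρout η₀ : ℝ}
    (hcoer : ∀ (L : lorentzGroup) (A : E4 →L[ℝ] E4) (d : E4) (G G' : E4 → E4 →L[ℝ] E4 →L[ℝ] ℝ) (V : Set E4),
      |((L : E4 ≃L[ℝ] E4) (E4.basisVector 0)) 0| ≤ γ →
      (∀ u w : E4, Minkowski.bilin (A u) w + Minkowski.bilin u (A w) = 0) →
      MetricCoord.IsMetricOn G V → MetricCoord.IsMetricOn G' V →
      (∀ y : E3, ρin ≤ ‖y‖ → ‖y‖ ≤ ρout → (E4.ofTimeSpace 0 y) ∈ V ∧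
        ‖G (E4.ofTimeSpace 0 y) - boostedKerrBilin L 0 M a (E4.ofTimeSpace 0 y)‖ ≤ η₀ ∧
        G' (E4.ofTimeSpace 0 y) = G (E4.ofTimeSpace 0 y) ∧
        fderiv ℝ G' (E4.ofTimeSpace 0 y) = fderiv ℝ G (E4.ofTimeSpace 0 y) ∧
        ∀ v : E4, fderiv ℝ (fderiv ℝ G') (E4.ofTimeSpace 0 y) v =
          fderiv ℝ (fderiv ℝ G) (E4.ofTimeSpace 0 y) v + (v 0) • (E4.dx 0).smulRight
            ((fderiv ℝ (Kerr.bilin M a) (poincareInv L 0 (E4.ofTimeSpace 0 y)) (A (poincareInv L 0 (E4.ofTimeSpace 0 y)) + d)).bilinearComp (((L : E4 ≃L[ℝ] E4).symm : E4 →L[ℝ] E4)) (((L : E4 ≃L[ℝ] E4).symm : E4 →L[ℝ] E4)) + (Kerr.bilin M a (poincareInv L 0 (E4.ofTimeSpace 0 y))).bilinearComp (A.comp (((L : E4 ≃L[ℝ] E4).symm : E4 →L[ℝ] E4))) (((L : E4 ≃L[ℝ] E4).symm : E4 →L[ℝ] E4)) + (Kerr.bilin M a (poincareInv L 0 (E4.ofTimeSpace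 0 y))).bilinearComp (((L : E4 ≃L[ℝ] E4).symm : E4 →L[ℝ] E4)) (A.comp (((L : E4 ≃L[ℝ] E4).symm : E4 →L[ℝ] E4))))) →
      ∃ y : E3, ρin ≤ ‖y‖ ∧ ‖y‖ ≤ ρout ∧
        c * (‖A (E4.basisVector 0)‖ + ‖E4.spatial d‖ + ‖a • A (E4.basisVector 3)‖) ≤
          ‖MetricCoord.ricAt G' (E4.ofTimeSpace 0 y) - MetricCoord.ricAt G (E4.ofTimeSpace 0 y)‖)
    (L : lorentzGroup) (hL : |((L : E4 ≃L[ℝ] E4) (E4.basisVector 0)) 0| ≤ γ) {A : E4 →L[ℝ] E4}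
    (hA : ∀ u w : E4, Minkowski.bilin (A u) w + Minkowski.bilin u (A w) = 0) (d : E4)
    {G : E4 → E4 →L[ℝ] E4 →L[ℝ] ℝ} {V : Set E4} (hG : IsMetricOn G V)
    (hVs : ∀ y : E3, ρin ≤ ‖y‖ → ‖y‖ ≤ ρout → E4.ofTimeSpace 0 y ∈ V ∧
      ‖G (E4.ofTimeSpace 0 y) - boostedKerrBilin L 0 M a (E4.ofTimeSpace 0 y)‖ ≤ η₀ ∧
      0 < Kerr.radius a (poincareInv L 0 (E4.ofTimeSpace 0 y)))
    {P : E4 → E4 →L[ℝ] E4 →L[ℝ] ℝ} (hP : ContDiffOn ℝ ∞ P V) (hPs : ∀ w ∈ V, ∀ u v, P w u v = P w v u) :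
    ∃ y : E3, ρin ≤ ‖y‖ ∧ ‖y‖ ≤ ρout ∧ ∃ V₁ : Set E4, E4.ofTimeSpace 0 y ∈ V₁ ∧ V₁ ⊆ V ∧
      IsMetricOn G V₁ ∧
      IsMetricOn (fun w ↦ G w + ((E4.dx 0) w - 0) ^ 2 • ((-(2⁻¹ : ℝ)) • P w)) V₁ ∧
      (fun w ↦ G w + ((E4.dx 0) w - 0) ^ 2 • ((-(2⁻¹ : ℝ)) • P w)) (E4.ofTimeSpace 0 y) =
        G (E4.ofTimeSpace 0 y) ∧
      fderiv ℝ (fun w ↦ G w + ((E4.dx 0) w - 0) ^ 2 • ((-(2⁻¹ : ℝ)) • P w)) (E4.ofTimeSpace 0 y) =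
        fderiv ℝ G (E4.ofTimeSpace 0 y) ∧
      (∀ v, fderiv ℝ (fderiv ℝ (fun w ↦ G w + ((E4.dx 0) w - 0) ^ 2 • ((-(2⁻¹ : ℝ)) • P w)))
        (E4.ofTimeSpace 0 y) v = fderiv ℝ (fderiv ℝ G) (E4.ofTimeSpace 0 y) v +
          (E4.dx 0) v • (E4.dx 0).smulRight (-P (E4.ofTimeSpace 0 y))) ∧
      c * (‖A (E4.basisVector 0)‖ + ‖E4.spatial d‖ + ‖a • A (E4.basisVector 3)‖) ≤
        4 * ‖sharpAt G (E4.ofTimeSpace 0 y)‖ * ‖(E4.dx 0 : E4 →L[ℝ] ℝ)‖ ^ 2 *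
          ‖((fderiv ℝ (Kerr.bilin M a) (poincareInv L 0 (E4.ofTimeSpace 0 y)) (A (poincareInv L 0 (E4.ofTimeSpace 0 y)) + d)).bilinearComp (((L : E4 ≃L[ℝ] E4).symm : E4 →L[ℝ] E4)) (((L : E4 ≃L[ℝ] E4).symm : E4 →L[ℝ] E4)) + (Kerr.bilin M a (poincareInv L 0 (E4.ofTimeSpace 0 y))).bilinearComp (A.comp (((L : E4 ≃L[ℝ] E4).symm : E4 →L[ℝ] E4))) (((L : E4 ≃L[ℝ] E4).symm : E4 →L[ℝ] E4)) + (Kerr.bilin M a (poincareInv L 0 (E4.ofTimeSpace 0 y))).bilinearComp (((L : E4 ≃L[ℝ] E4).symm : E4 →L[ℝ] E4)) (A.comp (((L : E4 ≃L[ℝ] E4).symm : E4 →L[ℝ] E4)))) - P (E4.ofTimeSpace 0 y)‖ +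
        ‖ricAt (fun w ↦ G w + ((E4.dx 0) w - 0) ^ 2 • ((-(2⁻¹ : ℝ)) • P w)) (E4.ofTimeSpace 0 y)‖ +
        ‖ricAt G (E4.ofTimeSpace 0 y)‖ := by
  set ζ : E4 →L[ℝ] ℝ := E4.dx 0 with hζ
  have hζa : ∀ v : E4, ζ v = v 0 := fun v ↦ rfl
  set W : E4 → E4 →L[ℝ] E4 →L[ℝ] ℝ := fun w ↦ ((fderiv ℝ (Kerr.bilin M a) (poincareInv L 0 w) (A (poincareInv L 0 w) + d)).bilinearComp (((L : E4 ≃L[ℝ] E4).symm : E4 →L[ℝ] E4)) (((L : E4 ≃L[ℝ] E4).symm : E4 →L[ℝ] E4)) + (Kerr.bilin M a (poincareInv L 0 w)).bilinearComp (A.comp (((L : E4 ≃L[ℝ] E4).symm : E4 →L[ℝ] E4))) (((L : E4 ≃L[ℝ] E4).symm : E4 →L[ℝ] E4)) + (Kerr.bilin M a (poincareInv L 0 w)).bilinearComp (((L : E4 ≃L[ℝ] E4).symm : E4 →L[ℝ] E4)) (A.comp (((L : E4 ≃L[ℝ] E4).symm : E4 →L[ℝ] E4)))) with hWdef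
  obtain ⟨hWc, hWs⟩ := higherOrder_varField L A d M a
  -- the working domain
  set V₀ : Set E4 := V ∩ {w : E4 | 0 < Kerr.radius a (poincareInv L 0 w)} with hV₀
  have hrad : IsOpen {w : E4 | 0 < Kerr.radius a (poincareInv L 0 w)} := by
    have hPf : (poincareInv L 0 : E4 → E4) = fun w ↦ ((L : E4 ≃L[ℝ] E4).symm : E4 →L[ℝ] E4) w :=
      funext fun w ↦ by simp [poincareInv]
    have hc : Continuous fun w : E4 ↦ Kerr.radius a (poincareInv L 0 w) := by
      rw [hPf]; exact (Kerr.continuous_radius a).comp (ContinuousLinearMap.continuous _)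
    exact isOpen_lt continuous_const hc
  have hV₀o : IsOpen V₀ := hG.isOpen.inter hrad
  have hG₀ : IsMetricOn G V₀ := KerrSchildChart.isMetricOn_mono hG hV₀o inter_subset_left
  have hW₀ : ContDiffOn ℝ ∞ W V₀ := hWc.mono inter_subset_right
  have hP₀ : ContDiffOn ℝ ∞ P V₀ := hP.mono inter_subset_left
  -- the two perturbations
  have hf : ContDiff ℝ ∞ (fun w : E4 ↦ (ζ w - 0) ^ 2) := (ζ.contDiff.sub contDiff_const).pow 2
  have hH' : ContDiffOn ℝ ∞ (fun w ↦ (2⁻¹ : ℝ) • W w) V₀ := hW₀.const_smul _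
  have hH₁ : ContDiffOn ℝ ∞ (fun w ↦ (-(2⁻¹ : ℝ)) • P w) V₀ := hP₀.const_smul _
  have hH's : ∀ w ∈ V₀, ∀ u v, ((2⁻¹ : ℝ) • W w) u v = ((2⁻¹ : ℝ) • W w) v u := fun w hw u v ↦ by
    simp only [_root_.smul_apply]; rw [hWs w hw.2 u v]
  have hH₁s : ∀ w ∈ V₀, ∀ u v, ((-(2⁻¹ : ℝ)) • P w) u v = ((-(2⁻¹ : ℝ)) • P w) v u := fun w hw u v ↦ by
    simp only [_root_.smul_apply]; rw [hPs w hw.1 u v]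
  obtain ⟨hG'm, hG'z⟩ := higherOrder_isMetricOn_add_smul hG₀ hf hH' hH's
  obtain ⟨hG₁m, hG₁z⟩ := higherOrder_isMetricOn_add_smul hG₀ hf hH₁ hH₁s
  set V₁' := {w | w ∈ V₀ ∧ ‖(ζ w - 0) ^ 2 • ((2⁻¹ : ℝ) • W w)‖ * ‖sharpAt G w‖ < 1} with hV₁'
  set V₂' := {w | w ∈ V₀ ∧ ‖(ζ w - 0) ^ 2 • ((-(2⁻¹ : ℝ)) • P w)‖ * ‖sharpAt G w‖ < 1} with hV₂'
  set V₁ : Set E4 := V₁' ∩ V₂' with hV₁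
  have hV₁o : IsOpen V₁ := hG'm.isOpen.inter hG₁m.isOpen
  have hV₁V₀ : V₁ ⊆ V₀ := fun w hw ↦ hw.1.1
  have hGV₁ : IsMetricOn G V₁ := KerrSchildChart.isMetricOn_mono hG₀ hV₁o hV₁V₀
  have hG'V₁ : IsMetricOn (fun w ↦ G w + (ζ w - 0) ^ 2 • ((2⁻¹ : ℝ) • W w)) V₁ :=
    KerrSchildChart.isMetricOn_mono hG'm hV₁o inter_subset_left
  have hG₁V₁ : IsMetricOn (fun w ↦ G w + (ζ w - 0) ^ 2 • ((-(2⁻¹ : ℝ)) • P w)) V₁ :=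
    KerrSchildChart.isMetricOn_mono hG₁m hV₁o inter_subset_right
  -- shell points
  have hx0 : ∀ y : E3, ζ (E4.ofTimeSpace 0 y) = 0 := fun y ↦ by rw [hζa]; exact E4.ofTimeSpace_apply_zero 0 y
  have hshell : ∀ y : E3, ρin ≤ ‖y‖ → ‖y‖ ≤ ρout → E4.ofTimeSpace 0 y ∈ V₀ ∧ E4.ofTimeSpace 0 y ∈ V₁ := by
    intro y h1 h2
    obtain ⟨hV, -, hr⟩ := hVs y h1 h2
    have h0 : E4.ofTimeSpace 0 y ∈ V₀ := ⟨hV, hr⟩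
    have hf0 : (ζ (E4.ofTimeSpace 0 y) - 0) ^ 2 = 0 := by rw [hx0]; norm_num
    exact ⟨h0, hG'z _ h0 hf0, hG₁z _ h0 hf0⟩
  -- jets of the perturbed fields at shell points
  have hjets : ∀ (H : E4 → E4 →L[ℝ] E4 →L[ℝ] ℝ), ContDiffOn ℝ ∞ H V₀ → ∀ x ∈ V₀, ζ x = 0 →
      (fun w ↦ G w + (ζ w - 0) ^ 2 • H w) x = G x ∧
      fderiv ℝ (fun w ↦ G w + (ζ w - 0) ^ 2 • H w) x = fderiv ℝ G x ∧
      ∀ v, fderiv ℝ (fderiv ℝ (fun w ↦ G w + (ζ w - 0) ^ 2 • H w)) x v =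
        fderiv ℝ (fderiv ℝ G) x v + ζ v • ζ.smulRight ((2 : ℝ) • H x) := by
    intro H hH x hx hζx
    obtain ⟨-, hp1, hp2, -⟩ := higherOrder_jets_smul_sq ζ 0 hV₀o hH hx hζx
    obtain ⟨ha1, ha2, -⟩ := fderiv_add_jets (H₂ := fun w ↦ (ζ w - 0) ^ 2 • H w) hG₀.contDiffOn
      (hf.contDiffOn.smul hH) hV₀o hx
    refine ⟨?_, ?_, fun v ↦ ?_⟩
    · show G x + (ζ x - 0) ^ 2 • H x = G x
      rw [hζx]; simp
    · rw [ha1, hp1, add_zero]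
    · rw [ha2, _root_.add_apply]
      congr 1
      ext w u
      rw [hp2 v w]
      simp only [_root_.smul_apply, ContinuousLinearMap.smulRight_apply, smul_eq_mul]
      ring
  -- apply the coercivity clause
  obtain ⟨y, hy1, hy2, hcb⟩ := hcoer L A d G (fun w ↦ G w + (ζ w - 0) ^ 2 • ((2⁻¹ : ℝ) • W w)) V₁
    hL hA hGV₁ hG'V₁ (fun y h1 h2 ↦ by
      obtain ⟨h0, h1'⟩ := hshell y h1 h2
      obtain ⟨-, hclose, -⟩ := hVs y h1 h2
      obtain ⟨j0, j1, j2⟩ := hjets _ hH' _ h0 (hx0 y)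
      refine ⟨h1', hclose, j0, j1, fun v ↦ ?_⟩
      rw [j2 v, smul_smul, mul_inv_cancel₀ (two_ne_zero (α := ℝ)), one_smul]
      rfl)
  obtain ⟨hy0, hyV₁⟩ := hshell y hy1 hy2
  set x : E4 := E4.ofTimeSpace 0 y with hx
  obtain ⟨j0, j1, j2⟩ := hjets _ hH₁ _ hy0 (hx0 y)
  have j2' : ∀ v, fderiv ℝ (fderiv ℝ (fun w ↦ G w + (ζ w - 0) ^ 2 • ((-(2⁻¹ : ℝ)) • P w))) x v =
      fderiv ℝ (fderiv ℝ G) x v + ζ v • ζ.smulRight (-P x) := fun v ↦ by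
    rw [j2 v, smul_smul, show (2 : ℝ) * -2⁻¹ = -1 by norm_num, neg_one_smul]
  obtain ⟨k0, k1, k2⟩ := hjets _ hH' _ hy0 (hx0 y)
  have k2' : ∀ v, fderiv ℝ (fderiv ℝ (fun w ↦ G w + (ζ w - 0) ^ 2 • ((2⁻¹ : ℝ) • W w))) x v =
      fderiv ℝ (fderiv ℝ G) x v + ζ v • ζ.smulRight (W x) := fun v ↦ by
    rw [k2 v, smul_smul, mul_inv_cancel₀ (two_ne_zero (α := ℝ)), one_smul]
  have hsym := higherOrder_norm_ricAt_changes_add_le hGV₁ hG₁V₁ hG'V₁ hyV₁ j0 j1 j2' k0 k1 k2'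
  refine ⟨y, hy1, hy2, V₁, hyV₁, fun w hw ↦ (hV₁V₀ hw).1, hGV₁, hG₁V₁, j0, j1, j2', ?_⟩
  have htri : ‖ricAt (fun w ↦ G w + (ζ w - 0) ^ 2 • ((2⁻¹ : ℝ) • W w)) x - ricAt G x‖ ≤
      ‖(ricAt (fun w ↦ G w + (ζ w - 0) ^ 2 • ((-(2⁻¹ : ℝ)) • P w)) x - ricAt G x) +
        (ricAt (fun w ↦ G w + (ζ w - 0) ^ 2 • ((2⁻¹ : ℝ) • W w)) x - ricAt G x)‖ +
      ‖ricAt (fun w ↦ G w + (ζ w - 0) ^ 2 • ((-(2⁻¹ : ℝ)) • P w)) x - ricAt G x‖ := by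
    have h := norm_sub_le ((ricAt (fun w ↦ G w + (ζ w - 0) ^ 2 • ((-(2⁻¹ : ℝ)) • P w)) x - ricAt G x) +
        (ricAt (fun w ↦ G w + (ζ w - 0) ^ 2 • ((2⁻¹ : ℝ) • W w)) x - ricAt G x))
      (ricAt (fun w ↦ G w + (ζ w - 0) ^ 2 • ((-(2⁻¹ : ℝ)) • P w)) x - ricAt G x)
    rwa [add_sub_cancel_left] at h
  have hlast : ‖ricAt (fun w ↦ G w + (ζ w - 0) ^ 2 • ((-(2⁻¹ : ℝ)) • P w)) x - ricAt G x‖ ≤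
      ‖ricAt (fun w ↦ G w + (ζ w - 0) ^ 2 • ((-(2⁻¹ : ℝ)) • P w)) x‖ + ‖ricAt G x‖ := norm_sub_le _ _
  have hWP : ‖-P x + W x‖ = ‖W x - P x‖ := by rw [neg_add_eq_sub]
  rw [hWP] at hsym
  linarith [hcb, htri, hlast, hsym]

/-- **Registered one-line carrier form** (`higherOrder_fderivKerrSymm_EF`) of
`higherOrder_fderiv_kerr_bilin_symm`. [folklore] -/
theorem higherOrder_fderivKerrSymm_EF : ∀ (M a : ℝ) {y : E4}, 0 < Kerr.radius a y → ∀ (v u w : E4), fderiv ℝ (Kerr.bilin M a) y v u w = fderiv ℝ (Kerr.bilin M a) y v w u :=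
  fun M a _ hy v u w ↦ higherOrder_fderiv_kerr_bilin_symm M a hy v u w

end Summit.FinalStateConjecture.FinalStateConjecture.Theorems.SublinearIsFree.Slaving

end
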